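import Mathlib
import Literature.Analysis.FluidPDE.HardSphereCollisionRecord
import Literature.MathematicalPhysics.KineticTheory.HardSphereEuler
import Literature.MathematicalPhysics.KineticTheory.HardSphereEulerProofs
import Summits.AtomisticToContinuum.HydrodynamicLimit.Theses.OneFlightGossipEngine
import Summits.AtomisticToContinuum.HydrodynamicLimit.Theorems.OneFlightGossipEngineOneFlightLayeredChaosRegimes
import Summits.AtomisticToContinuum.HydrodynamicLimit.Theorems.OneFlightGossipEngineOneFlightLayeredChaosFluxRegimes
import Summits.AtomisticToContinuum.HydrodynamicLimit.Theorems.OneFlightGossipEngineOneFlightLayeredChaosGapMeasurable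
import Summits.AtomisticToContinuum.HydrodynamicLimit.Theorems.OneFlightGossipEngineOneFlightLayeredChaosRecordGeometry
import Summits.AtomisticToContinuum.HydrodynamicLimit.Theorems.OneFlightGossipEngineOneFlightLayeredChaosFlightStartVel
import Summits.AtomisticToContinuum.HydrodynamicLimit.Theorems.OneFlightGossipEngineOneFlightLayeredChaosIsotropy
import Summits.AtomisticToContinuum.HydrodynamicLimit.Theorems.OneFlightGossipEngineOneFlightLayeredChaosJunkInvisibility
import Summits.AtomisticToContinuum.HydrodynamicLimit.Theorems.OneFlightGossipEngineOneFlightLayeredChaosWindowEvent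
import Summits.AtomisticToContinuum.HydrodynamicLimit.Theorems.OneFlightGossipEngineOneFlightLayeredChaosWrapGeometry
import Summits.AtomisticToContinuum.HydrodynamicLimit.Theorems.OneFlightGossipEngineOneFlightLayeredChaosNoWrap
import Summits.AtomisticToContinuum.HydrodynamicLimit.Theorems.OneFlightGossipEngineOneFlightLayeredChaosNoWrapThreshold
import Summits.AtomisticToContinuum.HydrodynamicLimit.Theorems.OneFlightGossipEngineOneFlightLayeredChaosSameStartWrap
import Summits.AtomisticToContinuum.HydrodynamicLimit.Theorems.OneFlightGossipEngineOneFlightLayeredChaosFirstFlightVelInput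
import Summits.AtomisticToContinuum.HydrodynamicLimit.Theorems.OneFlightGossipEngineOneFlightLayeredChaosDiscRegimes
import Summits.AtomisticToContinuum.HydrodynamicLimit.Theorems.OneFlightGossipEngineOneFlightLayeredChaosDiscTransfer
import Summits.AtomisticToContinuum.HydrodynamicLimit.Theorems.OneFlightGossipEngineOneFlightLayeredChaosFirstFlightGhostInput
import Summits.AtomisticToContinuum.HydrodynamicLimit.Theorems.OneFlightGossipEngineOneFlightLayeredChaosFirstFlightGhostTransfer
import Summits.AtomisticToContinuum.HydrodynamicLimit.Theorems.OneFlightGossipEngineOneFlightLayeredChaosTransQuasiInv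
import Summits.AtomisticToContinuum.HydrodynamicLimit.Theorems.OneFlightGossipEngineOneFlightLayeredChaosTransQuasiInvTransfer
import Summits.AtomisticToContinuum.HydrodynamicLimit.Theorems.OneFlightGossipEngineOneFlightLayeredChaosCellBoundaryLayer

/-!
# Skeleton — crux stmt-AtomisticToContinuum-14535 (`OneFlightLayeredChaos`), line `Sketch`, lead cycle c3
# (REGIME SPLIT × KINEMATIC LAYER; same-start atom split along `n`; v3: open stubs in their REDUCED, Φ-free / event-level forms)

Owned copy of line `Sketch`, RESHAPED by lead c3 (prover-line-stmt-AtomisticToContinuum-14535-c3-0, 2026-08-16 22Z).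
History: lead -0 registered `crux ⇐ oneFlightLayeredChaos_iff_one ⇐ stub_body_one` and landed the measurability /
duality / junk-invisibility layer; lead -1 factored the KINEMATICS (`stub_record_geometry` p97332, `stub_preVel_eq_flightStart_vel`
p98700, `stub_isotropy` p101251 — all LANDED) leaving the conditional FLUX LAW OF THE IMPACT VECTOR given 𝒢; lead c1 split
the crux's own defect by the inter-snapshot GAP over the LANDED frame `Theorems.OLC` (p96961: `Regime`, `RegimeTail/Body`,
`shortGap`, `mfTime`, `rhoStar`, `regimeBody_split`, `regimeBody_univ_of_split`, `oneFlightLayeredChaos_of_regimeBody_univ`);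
lead c2 composed the two (flux-form regime frame `RegimeFluxTail/Body` + kinematic transfer `stub_flux_transfer`, LANDED
p126158) and left three dynamical stubs on a PARTITION of the window event by the gap at the fixed cuts `{0, mfTime/20}`:
`stub_sameStart_flux` `{s_i = s_j}`, `stub_shortGap_flux` `{0 < |s_i − s_j| ≤ mfTime/20}`, `stub_longGap_flux` `{> mfTime/20}`.

THIS CYCLE (c3) the same-start atom `{s_i = s_j}` is split ALONG `n` (the regime `nZero = {n = 0}`):

* `n = 0` — `stub_firstFlight_flux : RegimeFluxBody θ₀ ((shortGap θ₀ 0).inter nZero)` (OPEN, the FIRST RUNG): the FIRST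
  collision of `i` with a FRESH partner `j` (`s_i = s_j = 0`): `𝒢 = σ(ℓ-cells + exact velocities of all particles at time 0, j)`,
  ONE snapshot, no inter-snapshot collision graph at all; content = "conditional Stosszahlansatz given coarse positions and
  exact velocities, `N`-uniform at fixed reduced density" (longitudinal smearing of shadows, Disproof §8 N1; thin boxes `ε/r`).
* `n ≥ 1` — on `Φ.good ∩ W` the event `{s_i = s_j}` says that `i` and its `n`-th partner `j` BOTH started their current flights
  at the same collision time `s = t_{n−1}(i) > 0`; collisions are binary, so `{i, j}` IS the pair that collided at `s`: the two
  spheres separate from contact in free flight and touch again at `t_n ≤ w` — impossible in `ℝ³`, so the relative displacement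
  WRAPS AROUND THE TORUS: `‖v_i − v_j‖ (t_n − s) ≥ 1 − 2ε_N`, hence one of the two travels `≥ 1/4` inside the window
  (`stub_sameStart_wrap_geometry`, deterministic, CLOSABLE), an event whose Gibbs probability vanishes as `N → ∞` at fixed
  `(σ, τ)` because the window `w = τ(N+1)^{-1/3}` shrinks while one-body speeds are Maxwellian and the law is stationary
  (`stub_noWrap`, CLOSABLE: union bound + Markov on the `lintegral` path length + Tonelli (`aemeasurable_uncurry_flow`) +
  `measurePreserving_flow_localGibbsLaw` + one-body Maxwellian marginal `lintegral_vel_localGibbsLaw_const` + Gaussian moment).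
  The no-wrap brick is the formal content of the item's "N₀ AFTER σ: flights never wrap" and is needed by every rung.
* glue (PROVED below): `regimeBody_sameStart_wrap : RegimeBody θ₀ ((shortGap θ₀ 0).inter nZero.compl)` (trivial bound
  `defect ≤ P(W ∩ X)`, `W ∩ X ∩ good ⊆ longPath` by the geometry stub, `P(goodᶜ) = 0`, `P(longPath) ≤ σ` by `stub_noWrap`),
  then `regimeBody_split` along `nZero` and the c2 assembly.

SKELETON v2 (lead c3, after waves 1–2; 15 files landed this cycle). The three dynamical stubs are now registered in their
REDUCED forms, through transfers LANDED in the tree: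
* `stub_firstFlight_velInput : FirstFlightVelInput θ₀` (OPEN) — velocities of all particles FROZEN, positions under the
  hard-core-uniform law `posGibbsMeasure`, a FIXED candidate pair `(i, j)`: on "i's first collision is in the window, with j,
  j fresh" the free-flight contact normal is flux-distributed and independent of everybody's ℓ-cells up to `b(v)`,
  `E_γ b ≤ Cσ^p/(N+1)`; ⟹ `stub_firstFlight_flux` by `OLC.regimeFluxBody_firstFlight_of_velInput` (p135058; chain
  FirstCollision p130275, FluxFunctional p130288, PairMeasurable p132168, FirstFlightInput p134073, FirstFlightPairInput p134775,
  EntranceLaw brick p130200).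
* `stub_shortGap_disc : RegimeDiscBody θ₀ (shortGap(1/20) ∖ shortGap(0))`, `stub_longGap_disc : RegimeDiscBody θ₀ (shortGap(1/20))ᶜ`
  (OPEN) — event-level UNIFORMITY ON THE ε-DISC, given the coarse past, of the transverse offset of the pair at the later
  flight start; ⟹ the flux stubs by `OLC.regimeFluxBody_of_regimeDiscBody` (p132181; DiscRegimes p130509 with Lambert/Cavalieri
  `flux_eq_discLaw`, LaterFlightStart p130510, brick DiscFlat p130379) and `NoWrap θ₀ 8⁻¹` (`Theorems.noWrap_of_threshold`,
  p133996).
* the same-start piece at `n ≥ 1` is CLOSED: `OLC.regimeBody_sameStart_wrap` (SameStartWrap p135189; stubs WrapGeometry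
  p127771, NoWrap p127909).
SKELETON v3 (after wave 3; 7 more files landed): one further reduction layer, LANDED:
* `stub_firstFlight_ghostInput : FirstFlightGhostInput θ₀` (OPEN) — the N-body flow Φ is GONE from the first rung: the event is
  the GHOST event (entrance time `t⋆` of the two free flights in the window + avoidance of the free paths of `i, j` by an
  arbitrary hard-sphere flow `Ψ` of the other `N − 1` spheres), ⟹ `FirstFlightVelInput` by `OLC.firstFlightVelInput_of_ghostInput`
  (p137050; GhostGlue p136464 `flow_comp_emb_eq` / `firstFlightEvent_subset_ghost`, GhostInput p136623, forward uniqueness).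
* `stub_shortGap_tqi`, `stub_longGap_tqi : RegimeTransQuasiInvBody θ₀ X` (OPEN) — event-level TRANSLATION QUASI-INVARIANCE, given
  the coarse past, of the joint law of `(ĝ, b)` at shifts up to the disc diameter, ⟹ `RegimeDiscBody` by
  `OLC.regimeDiscBody_of_transQuasiInv` (p136348; TransQuasiInv defs p135900, bundle brick DiscFlatBundle p135843, constant 38C).
* thin-box brick LANDED: `OLC.cellBoundaryLayer`, `volume_cellBoundaryLayer_le` (≤ 12η/r), `coarseCell_eq_of_not_mem_cellBoundaryLayer`
  (CellBoundaryLayer p135650) — the `ε/r` price of cell conditioning, for whoever proves the three inputs.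
Registered stubs after v3: `stub_firstFlight_ghostInput`, `stub_shortGap_tqi`, `stub_longGap_tqi` (open; the lead holds
`stub_longGap_tqi`); everything else in this file is a wrapper of a tree theorem. Composition `OneFlightLayeredChaos_proof`
concludes the crux BY NAME via `oneFlightLayeredChaos_of_regimeBody_univ`.

Earlier closed lemmas of the line live in Theorems (`bayes_tv_defect` p86136, `transverse_offset_eq_zero_iff` p86746,
EventDuality p89177, JunkInvisibility p89239, WindowEvent p89538, CollisionTime p90043, KickEvent p91121, CoarsePast p92662,
PastSigmaVersion p94104, SingularSplit p97860, Regimes p96961, GapMeasurable p98225, RecordGeometry p97332, FlightStartVel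
p98700, Isotropy p101251, FluxRegimes p126158, Negative/MeshMonotone p121771) and are not repeated here.
-/

open scoped BigOperators ENNReal
open MeasureTheory Set
open Literature.Analysis.FluidPDE Literature.MathematicalPhysics.KineticTheory
open Summit.AtomisticToContinuum.HydrodynamicLimit.Theorems.OLC

namespace Summit.AtomisticToContinuum.HydrodynamicLimit.Cruxes.OneFlightLayeredChaos.Sketch

noncomputable section

/-! ## Frame (all LANDED): `OLC.Regime`, `shortGap`, `RegimeBody/RegimeFluxBody/RegimeDiscBody`, `OLC.nZero = {n = 0}`
(SameStartWrap), `OLC.NoWrap θ₀ c` (DiscRegimes), `OLC.FirstFlightVelInput` (FirstFlightVelInput). -/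

/-! ## The stubs -/

/-- CLOSED (was the closable stub `stub_flux_transfer`; LANDED by the c2 wave as
`Summit.AtomisticToContinuum.HydrodynamicLimit.Theorems.OLC.stub_flux_transfer`, p126158, file
`Theorems/OneFlightGossipEngineOneFlightLayeredChaosFluxRegimes.lean`). Kinematic transfer: for every regime `X`, the flux-form
body on `X` implies the crux's own body on `X`. -/
theorem stub_flux_transfer {θ₀ : ℝ} (X : Regime) (h : RegimeFluxBody θ₀ X) : RegimeBody θ₀ X :=
  Summit.AtomisticToContinuum.HydrodynamicLimit.Theorems.OLC.stub_flux_transfer X h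

/-- STUB (dynamical; OPEN — THE FIRST RUNG in its Φ-free reduced form `OLC.FirstFlightGhostInput`, LANDED def p136623). With
the velocities `v` of ALL `N + 1` particles frozen and the positions distributed by the hard-core-uniform law
`posGibbsMeasure 1 ε (N+1)`, for a FIXED candidate pair `j ≠ i`, an arbitrary label embedding `emb` of the others and an
ARBITRARY hard-sphere flow `Ψ` of those `N − 1` spheres (the GHOST ENVIRONMENT, evolved without `i, j`), on the ghost event
`Fghost` = "the entrance time `t⋆` of the two FREE flights of `i, j` lies in `(0, w]` and no ghost sphere comes within `ε` of
either free path on `(0, t⋆]`": for all measurable `U ⊆ ℝ³`, `T ⊆ (cells)`,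
`|μ{Fghost ∧ ω⋆ ∈ U ∧ cells ∈ T} − Flux_{ĝ(v)}(U)·μ{Fghost ∧ cells ∈ T}| ≤ b(v)`, `∫ b dγ ≤ C σ^p/(N+1)`, `N ≥ N₀(σ, τ)`,
`ω⋆` = contact normal of the free flights at `t⋆`. This is the conditional Stosszahlansatz given coarse positions and exact
velocities with ALL crux bookkeeping and the N-body flow stripped (chain Ghost ⇒ Vel ⇒ Pair ⇒ Input ⇒ flux form, p137050 /
p135058 / p134775 / p134073). What remains inside (worker audit `work/stubs/stub_firstFlight_flux.md` §3): the entrance law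
(DONE, `OLC.lintegral_entranceLaw_pair` p130200) + thin boxes (brick DONE, `OLC.volume_cellBoundaryLayer_le` p135650) +
R3c SHADOW SMEARING of the ghost avoidance functional — the open core (unprinted; nearest BGSS 2023 Thm 3 / Pulvirenti–Simonella
2017 at Boltzmann–Grad; Chernov–Dolgopyat standard pairs for one particle; Marklof–Strömbergsson shows non-uniformity for a
PERIODIC environment, so the Gibbs average over the environment is essential). -/
theorem stub_firstFlight_ghostInput (θ₀ : ℝ) (hθ : 0 < θ₀) : FirstFlightGhostInput θ₀ := by
  sorry

/-- DERIVED (was the v2 stub `stub_firstFlight_velInput`): the velocity-fibre input from the ghost input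
(`OLC.firstFlightVelInput_of_ghostInput`, p137050). -/
theorem stub_firstFlight_velInput (θ₀ : ℝ) (hθ : 0 < θ₀) : FirstFlightVelInput θ₀ :=
  firstFlightVelInput_of_ghostInput hθ (stub_firstFlight_ghostInput θ₀ hθ)

/-- DERIVED (was the registered stub `stub_firstFlight_flux`): the flux-form body on the first-flight atom
`{s_i = s_j} ∩ {n = 0}` from its reduced form, by the LANDED reduction `OLC.regimeFluxBody_firstFlight_of_velInput`
(p135058). -/
theorem stub_firstFlight_flux (θ₀ : ℝ) (hθ : 0 < θ₀) : RegimeFluxBody θ₀ ((shortGap θ₀ 0).inter nZero) :=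
  regimeFluxBody_firstFlight_of_velInput hθ (stub_firstFlight_velInput θ₀ hθ)

/-- CLOSED (was the closable stub `stub_sameStart_wrap_geometry`; LANDED by the c3 wave as
`Summit.AtomisticToContinuum.HydrodynamicLimit.Theorems.stub_sameStart_wrap_geometry`, p127771, file
`Theorems/OneFlightGossipEngineOneFlightLayeredChaosWrapGeometry.lean`). **A same-start double collision inside the window
wraps around the torus**: on `Φ.good`, if `i` has at least `n + 1 ≥ 2` collisions in `(0, w]` and the flight starts of `i`
and of its `n`-th partner before `t_n` coincide, the pair collided at that common start `s > 0`, flies freely and touches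
again at `t_n ≤ w`, which on `𝕋³` forces `‖v_i − v_j‖(t_n − s) ≥ 1 − 2ε > 1/2`, so some particle has `lintegral` path
length `≥ 1/4` on `(0, w]`. -/
theorem stub_sameStart_wrap_geometry {σ : ℝ} {N : ℕ} (hε : 0 < hsDiameter σ N) (hε4 : hsDiameter σ N < 4⁻¹)
    (Φ : HardSphereFlow (Torus.geometry (Fin 3)) (hsDiameter σ N) (N + 1)) (i : Fin (N + 1)) {n : ℕ} (hn : 1 ≤ n)
    (w : ℝ) {z : Config (N + 1) (Fin 3) T3} (hz : z ∈ Φ.good)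
    (hW : n + 1 ≤ Set.ncard (collisionTimesOf (Torus.geometry (Fin 3)) (hsDiameter σ N) (fun t => Φ.flow t z) i ∩
      Set.Ioc 0 w))
    (hs : flightStart (Torus.geometry (Fin 3)) (hsDiameter σ N) (fun t => Φ.flow t z) 0 i (Φ.nthCollisionTimeOf i n z) =
      flightStart (Torus.geometry (Fin 3)) (hsDiameter σ N) (fun t => Φ.flow t z) 0 (Φ.nthPartnerOf i n z)
        (Φ.nthCollisionTimeOf i n z)) :
    ∃ k : Fin (N + 1), ENNReal.ofReal (1 / 4) ≤ ∫⁻ t in Set.Ioc 0 w, ENNReal.ofReal ‖(Φ.flow t z k).2‖ :=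
  Summit.AtomisticToContinuum.HydrodynamicLimit.Theorems.stub_sameStart_wrap_geometry hε hε4 Φ i hn w hz hW hs

/-- CLOSED (was the closable stub `stub_noWrap`; LANDED by the c3 wave as
`Summit.AtomisticToContinuum.HydrodynamicLimit.Theorems.stub_noWrap`, p127909, file
`Theorems/OneFlightGossipEngineOneFlightLayeredChaosNoWrap.lean`). **No wrap-around inside the kinetic window**: under the
stationary Gibbs law the probability that some particle has `lintegral` path length `≥ 1/4` on `(0, τ(N+1)^{-1/3}]` is
`≤ δ` for `N ≥ N₀(θ₀, σ, τ, δ)` (union bound, Markov, Tonelli via `aemeasurable_uncurry_flow`, stationarity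
`measurePreserving_flow_localGibbsLaw`, Maxwellian quartic moment; total `≍ θ₀² τ⁴ (N+1)^{-1/3}`). -/
theorem stub_noWrap {θ₀ : ℝ} (hθ : 0 < θ₀) {σ : ℝ} (hσ : 0 < σ) (hσ2 : σ ≤ 2⁻¹) {τ : ℝ} (hτ : 0 < τ) {δ : ℝ}
    (hδ : 0 < δ) :
    ∃ N₀ : ℕ, ∀ N : ℕ, N₀ ≤ N → ∀ Φ : HardSphereFlow (Torus.geometry (Fin 3)) (hsDiameter σ N) (N + 1),
      localGibbsLaw σ (fun _ => 1) (fun _ => 0) (fun _ => θ₀) N Φ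
          {z | ∃ k : Fin (N + 1), ENNReal.ofReal (1 / 4) ≤
            ∫⁻ t in Set.Ioc 0 (τ * ((N + 1 : ℕ) : ℝ) ^ (-(1 / 3 : ℝ))), ENNReal.ofReal ‖(Φ.flow t z k).2‖} ≤
        ENNReal.ofReal δ :=
  Summit.AtomisticToContinuum.HydrodynamicLimit.Theorems.stub_noWrap hθ hσ hσ2 hτ hδ

/-- No wrap-around at threshold `1/8` (LANDED `Theorems.noWrap_of_threshold`, p133996): the form consumed by the disc
transfer. -/
theorem noWrap_eighth {θ₀ : ℝ} (hθ : 0 < θ₀) : NoWrap θ₀ 8⁻¹ :=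
  fun _σ hσ hσ2 _τ hτ _δ hδ =>
    Summit.AtomisticToContinuum.HydrodynamicLimit.Theorems.noWrap_of_threshold hθ (by norm_num) hσ hσ2 hτ hδ

/-- STUB (dynamical; OPEN; the SHORT-GAP / FLOPPY regime `{0 < |s_i − s_j| ≤ mfTime/20}` in its reduced EVENT-LEVEL form
`OLC.RegimeTransQuasiInvBody`, LANDED def p135900). Given the coarse past `𝒢` (ℓ-cells + exact velocities of all particles at
the two flight starts, + partner), on the short-gap event the joint law of `(ĝ, b)` — `b = ε⁻¹ Π_{ĝ^⊥} sepVec(x_i(s⁺), x_j(s⁺))`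
the transverse offset of the pair at the later flight start — is TRANSLATION QUASI-INVARIANT in `b` at every shift `Π_{ĝ^⊥}δ`
(inside the unit disc of `ĝ^⊥`) up to `C σ^p` in `L¹(𝒢)`: for all `δ`, measurable `S`, `E ∈ 𝒢`,
`|P(W ∩ {(ĝ,b) ∈ S, b ∈ D, b − Πδ ∈ D} ∩ (X ∩ E)) − P(W ∩ {(ĝ, b + Πδ) ∈ S, b + Πδ ∈ D, b ∈ D} ∩ (X ∩ E))| ≤ C σ^p`,
`N ≥ N₀(σ, τ, n)`; ⟹ disc-uniformity by `OLC.regimeDiscBody_of_transQuasiInv` (p136348, bundle brick p135843) ⟹ flux form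
(p132181). Content (cards slider-coordinates / collision-time-coordinates / comoving-tube-marking; NOTES §D2(a)(b); worker audit
`work/stubs/stub_shortGap_flux.md`): (R1) the inter-snapshot collision forest + normals are 𝒢-decodable mod null sets
(`exists_preimage_symmDiff_null_of_mutuallySingular` p97860 + transversality of images of distinct sparse itineraries);
(R2) given them the sub-cell offsets are Lebesgue on the itinerary's affine fibre (`hardSphere_entranceParametrization_holds`
iterated); (R3) the shift `b ↦ b + Πδ` is realised by translating `i`'s (or `j`'s) floppy grain rigidly by `εδ`, at the price
of thin boxes (`volume_cellBoundaryLayer_le`, ε/r), cycles through both anchors (σ³|log σ|), arrival-order swaps (σ³), and —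
the open core — the VACANCY re-weighting of third bodies along the swept tube (ε/r-flat only AFTER averaging the other grains'
offsets; a rigid shift alone sweeps `O(1)` fresh encounters, TRIAGE-r1-1 (S1)). Unprinted (nearest Chernov–Dolgopyat 2009,
Bálint–Tóth 2008, BGSS 2023 Thm 3). Expected `p ≤ 3`. -/
theorem stub_shortGap_tqi (θ₀ : ℝ) (hθ : 0 < θ₀) :
    RegimeTransQuasiInvBody θ₀ ((shortGap θ₀ (1 / 20)).inter (shortGap θ₀ 0).compl) := by
  sorry

/-- DERIVED (was the v2 stub `stub_shortGap_disc`): disc-uniformity on the short-gap regime from translation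
quasi-invariance (`OLC.regimeDiscBody_of_transQuasiInv`, p136348). -/
theorem stub_shortGap_disc (θ₀ : ℝ) (hθ : 0 < θ₀) :
    RegimeDiscBody θ₀ ((shortGap θ₀ (1 / 20)).inter (shortGap θ₀ 0).compl) :=
  regimeDiscBody_of_transQuasiInv hθ _ (stub_shortGap_tqi θ₀ hθ)

/-- DERIVED (was the registered stub `stub_shortGap_flux`): flux form on the short-gap regime from the disc form and
no-wrap at `1/8` (`OLC.regimeFluxBody_of_regimeDiscBody`, p132181). -/
theorem stub_shortGap_flux (θ₀ : ℝ) (hθ : 0 < θ₀) :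
    RegimeFluxBody θ₀ ((shortGap θ₀ (1 / 20)).inter (shortGap θ₀ 0).compl) :=
  regimeFluxBody_of_regimeDiscBody hθ _ (stub_shortGap_disc θ₀ hθ) (noWrap_eighth hθ)

/-- STUB (dynamical; OPEN; the LONG-GAP regime `{|s_i − s_j| > mfTime/20}` in its reduced EVENT-LEVEL form
`OLC.RegimeTransQuasiInvBody` — contains the rigid / DUST regime, the crux's open core; the lead's stub). Given `𝒢`, on the
long-gap event the joint law of `(ĝ, b)` is translation quasi-invariant in `b` at shifts inside the disc up to `C σ^p` in `L¹(𝒢)`,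
`N ≥ N₀`; ⟹ disc-uniformity (p136348) ⟹ flux form (p132181). Content: up to `u* ≈ 2.8 t_mf` the short-gap analysis; beyond
(σ-FREE mass `≈ e^{−u*}`) the exact two-snapshot fibre is locally a point per branch and globally a dust of `exp(Θ(N))`
admissible branches (coarea lower bound, COAREA-MULTIPLICITY.md / kit j017669; NOTES §B, §D2(c)(d); Disproof §6, §8 N2–N6): a
shift of `b` by `Πδ` is NOT realised inside a rigid branch (no free clock) but by passing to a NEIGHBOURING BRANCH (a
data-preserving local re-pairing of `l`'s or `k`'s collision slots), so the stub asks for ABUNDANCE OF DATA-PRESERVING LOCAL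
RE-PAIRINGS with controlled Jacobians (N6) ⟺ no condensation of the class posterior (IPR identity, Disproof §8a) ⟺ the
posterior-weighted branch centres are equidistributed at scale `ε`. Conditioning on 𝒢 ONLY (given `𝒢 ∨ σ(branch)` it is FALSE:
3-ring law, TV 0.22–0.52). Beyond print and behind the catalogued barriers `Literature/Barriers/AtomisticToContinuum/DiluteRegime`,
`BoltzmannHypothesis`, `MacroErgodicityHypothesis`. -/
theorem stub_longGap_tqi (θ₀ : ℝ) (hθ : 0 < θ₀) : RegimeTransQuasiInvBody θ₀ (shortGap θ₀ (1 / 20)).compl := by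
  sorry

/-- DERIVED (was the v2 stub `stub_longGap_disc`): disc-uniformity on the long-gap regime from translation quasi-invariance
(`OLC.regimeDiscBody_of_transQuasiInv`, p136348). -/
theorem stub_longGap_disc (θ₀ : ℝ) (hθ : 0 < θ₀) : RegimeDiscBody θ₀ (shortGap θ₀ (1 / 20)).compl :=
  regimeDiscBody_of_transQuasiInv hθ _ (stub_longGap_tqi θ₀ hθ)

/-- DERIVED (was the registered stub `stub_longGap_flux`): flux form on the long-gap regime from the disc form and no-wrap
at `1/8` (`OLC.regimeFluxBody_of_regimeDiscBody`, p132181). -/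
theorem stub_longGap_flux (θ₀ : ℝ) (hθ : 0 < θ₀) : RegimeFluxBody θ₀ (shortGap θ₀ (1 / 20)).compl :=
  regimeFluxBody_of_regimeDiscBody hθ _ (stub_longGap_disc θ₀ hθ) (noWrap_eighth hθ)

/-! ## Assembly (proved) -/

/-- The short-gap regime is measurable on the good set (landed, p98225). -/
theorem measurableSet_good_inter_shortGap (θ₀ u₀ σ : ℝ) (n N : ℕ)
    (Φ : HardSphereFlow (Torus.geometry (Fin 3)) (hsDiameter σ N) (N + 1)) (i : Fin (N + 1)) :
    MeasurableSet (Φ.good ∩ shortGap θ₀ u₀ σ n N Φ i) :=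
  Summit.AtomisticToContinuum.HydrodynamicLimit.Theorems.stub_measurableSet_gap_le Φ i n (u₀ * mfTime σ θ₀ N)

/-- CLOSED glue (LANDED as `OLC.regimeBody_sameStart_wrap`, p135189): the crux's body on the same-start event at `n ≥ 1`
(torus wrap-around; from `stub_sameStart_wrap_geometry` + `stub_noWrap`). -/
theorem regimeBody_sameStart_wrap {θ₀ : ℝ} (hθ : 0 < θ₀) : RegimeBody θ₀ ((shortGap θ₀ 0).inter nZero.compl) :=
  Summit.AtomisticToContinuum.HydrodynamicLimit.Theorems.OLC.regimeBody_sameStart_wrap hθ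

/-- The crux's body on the trivial regime, for every temperature, from the stubs: transfer each flux-form regime body to
the crux's form (`stub_flux_transfer`, landed), glue the wrap-around piece (`regimeBody_sameStart_wrap`), and split three
times along measurable events (`regimeBody_split` / `regimeBody_univ_of_split`, landed): `univ = shortGap(1/20) ⊔ ∁`,
`shortGap(1/20) = shortGap(0) ⊔ (shortGap(1/20) ∖ shortGap(0))` (`shortGap(1/20) ∩ shortGap(0) = shortGap(0)` pointwise),
`shortGap(0) = (shortGap(0) ∩ {n = 0}) ⊔ (shortGap(0) ∩ {n ≥ 1})`. -/
theorem regimeBody_univ (θ₀ : ℝ) (hθ : 0 < θ₀) : RegimeBody θ₀ Regime.univ := by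
  have hY : ∀ (c σ : ℝ) (n N : ℕ) (Φ : HardSphereFlow (Torus.geometry (Fin 3)) (hsDiameter σ N) (N + 1))
      (i : Fin (N + 1)), MeasurableSet (Φ.good ∩ shortGap θ₀ c σ n N Φ i) :=
    fun c σ n N Φ i => measurableSet_good_inter_shortGap θ₀ c σ n N Φ i
  -- the atom is the intersection of the two short-gap regimes
  have hatom : (shortGap θ₀ (1 / 20)).inter (shortGap θ₀ 0) = shortGap θ₀ 0 := by
    funext σ n N Φ i
    ext z
    simp only [Regime.inter, shortGap, Set.mem_inter_iff, Set.mem_setOf_eq, zero_mul]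
    constructor
    · exact fun h => h.2
    · intro h
      refine ⟨h.trans ?_, h⟩
      have hm : 0 ≤ mfTime σ θ₀ N := by
        unfold mfTime
        exact div_nonneg (Real.rpow_nonneg (by positivity) _) (by positivity)
      positivity
  -- the same-start atom, split along `n`
  have hsame : RegimeBody θ₀ (shortGap θ₀ 0) :=
    regimeBody_split hθ (X := shortGap θ₀ 0) (Y := nZero) measurableSet_good_inter_nZero
      (stub_flux_transfer _ (stub_firstFlight_flux θ₀ hθ)) (regimeBody_sameStart_wrap hθ)
  have hshort : RegimeBody θ₀ (shortGap θ₀ (1 / 20)) := by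
    refine regimeBody_split hθ (X := shortGap θ₀ (1 / 20)) (Y := shortGap θ₀ 0) (hY 0) ?_ ?_
    · rw [hatom]
      exact hsame
    · exact stub_flux_transfer _ (stub_shortGap_flux θ₀ hθ)
  exact regimeBody_univ_of_split hθ (Y := shortGap θ₀ (1 / 20)) (hY (1 / 20)) hshort
    (stub_flux_transfer _ (stub_longGap_flux θ₀ hθ))

/-- Composition: the crux BY NAME, from `regimeBody_univ` by the landed frame bookkeeping
`oneFlightLayeredChaos_of_regimeBody_univ` (`∃ ρ` witnessed by `ρ⋆(σ)`, the activity cancels from the canonical law). -/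
theorem OneFlightLayeredChaos_proof :
    Summit.AtomisticToContinuum.HydrodynamicLimit.Theses.OneFlightGossipEngine.OneFlightLayeredChaos :=
  oneFlightLayeredChaos_of_regimeBody_univ regimeBody_univ

end

end Summit.AtomisticToContinuum.HydrodynamicLimit.Cruxes.OneFlightLayeredChaos.Sketch
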